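import Literature.Barriers.AnomalousDissipation.GravestModeLaminarAttractorShellPincer
import HarnessLib

/-!
# The shell pincer for an arbitrary force: the injection defect, and Tran–Shepherd's
time-mean / "monoscale-like" constraint at the Galerkin level
(barrier-audit proof file of `Literature/Barriers/AnomalousDissipation/GravestModeLaminarAttractor`,
D-0021 audit 2026-08-15, generation 7; extends the single-shell file
`GravestModeLaminarAttractorShellPincer` of generation 6)

Generation 6 recorded Tran–Shepherd's dynamical constraint for a force valued in ONE Stokes
eigenspace (`|k|² = m` on the Fourier support): the signed shell excess
`ξ = ‖u‖² - λ|u|²`, `λ = 4π²m`, obeys `½ξ' ≤ -νλξ`. For a GENERAL force the same computation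
(2-D periodic, `(B(u,u),Au) = (B(u,u),u) = 0`) leaves exactly one extra term, the
**injection defect** `∑_k 4π²(|k|² - m) Re⟪û_k, f̂_k⟫ = (f, Au) - λ(f, u)`:

  `½ ξ' ≤ -νλ ξ + [(f, Au) - λ (f, u)]`.

Tran–Shepherd (Physica D 165 (2002), §1 and §4, last two paragraphs of §4) call a force
"monoscale-like" over a band `λ_min ≤ λ_k ≤ λ_max` when `(Au, f) ≤ λ_max (u, f)` (and
`(u, f) ≥ 0`); then "((xi)) [holds] with the equality replaced by `≤` and with `λ_s` replaced by
`λ_max`", so the constraint `‖u‖₁² ≤ λ_max‖u‖²` holds on the attractor, and "if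
((monoscale-like)) only holds in a time-mean sense ... `⟨‖u‖₁²⟩ ≤ λ_max⟨‖u‖²⟩` and the
dynamical constraint holds in the time mean". The complementary configuration — a force that
"simultaneously injects energy at higher wavenumbers and removes energy at lower (though
possibly nearby) wavenumbers" (op. cit. §1, after Constantin–Foias–Manley, Phys. Fluids 6
(1994) 427) — is the only one in which the enstrophy-to-energy ratio of a band-limited steady
forcing escapes `λ_max`.

This file proves, at the Galerkin level of the tree (`Torus.galerkinField`, `galerkinRHS`) and
for every real level `m` and `ν ≥ 0`:

* `sum_shellWeight_mul_re_inner_galerkinField_le_add_defect` — for ANY force coefficients `g`,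
  `∑_{k∈S} w_m(k) Re⟪c_k, V(g,c)_k⟫ ≤ -4π²mν ∑_{k∈S} w_m(k)‖c_k‖² + ∑_{k∈S} w_m(k) Re⟪c_k, g_k⟫`,
  `w_m(k) = 4π²(|k|² - m)` (the single-shell lemma of generation 6 is the case where the defect
  vanishes identically);
* `shellWeight_defect_nonpos_of_band` — for a force supported at levels `|k|² ≤ m` whose lower
  modes (`|k|² < m`) receive non-negative instantaneous work `Re⟪c_k, g_k⟫ ≥ 0`, the defect is
  `≤ 0` (shellwise form of Tran–Shepherd's monoscale-like hypothesis with `λ = λ_max`);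
* `galerkin_shellExcess_le_mul_exp_of_defect_nonpos` — along a Galerkin solution whose
  injection defect is non-positive on `[0, t]` ("monoscale-like" pointwise in time),
  `ξ(t) ≤ ξ(s)e^{-8π²mν(t-s)}` for `0 ≤ s ≤ t`: the dynamical constraint with `λ_max`.

Consequence recorded in the barrier block of `Marchioro1986_globalAttraction` (design rule for
two-and-a-half-dimensional witnesses of `Literature.Turb.ZerothLaw`): with a band-limited steady
planar force, ν-uniform (mean) `H¹` bounds on the planar flow — and with them the renormalised,
anomaly-free transport of the third component — fail only if the flow does NEGATIVE mean work
against the lower forced shells, `∑_{λ_k<λ_max}(λ_max - λ_k)⟨(v, g_k)⟩ < 0`, by an amount `≫ ν`.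

## References

* C. V. Tran, T. G. Shepherd, Physica D 165 (2002) 199–212 = arXiv:nlin/0201002, §1 (definition
  of monoscale-like forcing; the Constantin–Foias–Manley escape), §4 eq. (ξ), (constraint) and the
  two closing paragraphs (monoscale-like and time-mean forms). [`TranShepherd2002`]
* P. Constantin, C. Foias, O. P. Manley, Phys. Fluids 6 (1994) 427–429. [`ConstantinFoiasManley1994`]
* C. Foias, O. Manley, R. Rosa, R. Temam, *Navier–Stokes Equations and Turbulence*, CUP 2001,
  App. III.A.4 (A.32) (the case `m = 1`).
-/

open MeasureTheory Set Filter Topology UnitAddTorus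
open scoped ENNReal NNReal InnerProductSpace

noncomputable section

namespace Literature.Barriers.AnomalousDissipation

open Literature.Analysis.FunctionSpaces Literature.Analysis.FunctionSpaces.Torus
open Literature.Analysis.FluidPDE Literature.Analysis.FluidPDE.Torus

section Weighted

variable {S : Finset (Fin 2 → ℤ)}

/-- **The shell-weighted Galerkin field for an arbitrary force: the injection defect.** Let
`S ⊂ ℤ²` be symmetric, `c` conjugate symmetric and transversal on `S`, `ν ≥ 0`, `m ∈ ℝ`, and
let `g` be ANY force coefficients. With `w_m(k) = 4π²(|k|² - m)`,
`∑_{k∈S} w_m(k) Re⟪c k, V(g,c) k⟫ ≤ -(4π²mν) ∑_{k∈S} w_m(k)‖c k‖² + ∑_{k∈S} w_m(k) Re⟪c k, g k⟫`: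
the convection drops out ((II.A.62) and energy conservation), the Stokes part is bounded
termwise (`ν w_m(k)² ‖c_k‖² ≥ 0`), and the force survives exactly through the defect
`(f, Au) - λ(f, u)` (Tran–Shepherd 2002, §4: eq. (ξ) "with the equality replaced by `≤`" once
the defect has a sign). [cite: TranShepherd2002, §4 eq. (ξ) and closing paragraphs] -/
theorem sum_shellWeight_mul_re_inner_galerkinField_le_add_defect {ν : ℝ} (hν : 0 ≤ ν)
    (hS : ∀ k ∈ S, -k ∈ S) {g c : (Fin 2 → ℤ) → EuclideanSpace ℂ (Fin 2)} (hc : IsConjSymm c)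
    (hcT : IsTransversal S c) (m : ℝ) :
    ∑ k ∈ S, (4 * Real.pi ^ 2 * (freqNormSq k - m)) * (inner ℂ (c k) (galerkinField ν S g c k)).re ≤
      -(4 * Real.pi ^ 2 * m * ν) * ∑ k ∈ S, (4 * Real.pi ^ 2 * (freqNormSq k - m)) * ‖c k‖ ^ 2 +
        ∑ k ∈ S, (4 * Real.pi ^ 2 * (freqNormSq k - m)) * (inner ℂ (c k) (g k)).re := by
  -- split the field
  have hsplit : ∀ k ∈ S, (inner ℂ (c k) (galerkinField ν S g c k)).re =
      -(ν * (4 * Real.pi ^ 2 * (freqNormSq k * ‖c k‖ ^ 2))) +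
        ((inner ℂ (c k) (g k)).re - (inner ℂ (c k) (convectionCoeff S c c k)).re) := by
    intro k hk
    rw [galerkinField, inner_add_right, Complex.add_re, inner_leraySym_right_of_transversal _ _
      (hcT k hk), inner_sub_right, Complex.sub_re, inner_neg_right, Complex.neg_re,
      inner_smul_right, Complex.re_ofReal_mul]
    have hcc : (inner ℂ (c k) (c k)).re = ‖c k‖ ^ 2 := inner_self_eq_norm_sq (𝕜 := ℂ) (c k)
    rw [hcc]
    ring
  have hsum : ∑ k ∈ S, (4 * Real.pi ^ 2 * (freqNormSq k - m)) * (inner ℂ (c k) (galerkinField ν S g c k)).re =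
      (∑ k ∈ S, -(ν * ((4 * Real.pi ^ 2 * (freqNormSq k - m)) * (4 * Real.pi ^ 2 * freqNormSq k) * ‖c k‖ ^ 2))) +
        (∑ k ∈ S, (4 * Real.pi ^ 2 * (freqNormSq k - m)) * (inner ℂ (c k) (g k)).re) -
          ∑ k ∈ S, (4 * Real.pi ^ 2 * (freqNormSq k - m)) * (inner ℂ (c k) (convectionCoeff S c c k)).re := by
    rw [← Finset.sum_add_distrib, ← Finset.sum_sub_distrib]
    refine Finset.sum_congr rfl fun k hk => ?_
    rw [hsplit k hk]
    ring
  -- the convection drops out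
  have hconv : ∑ k ∈ S, (4 * Real.pi ^ 2 * (freqNormSq k - m)) *
      (inner ℂ (c k) (convectionCoeff S c c k)).re = 0 := by
    have hterm : ∀ k ∈ S, (4 * Real.pi ^ 2 * (freqNormSq k - m)) *
        (inner ℂ (c k) (convectionCoeff S c c k)).re =
        4 * Real.pi ^ 2 * (freqNormSq k * (inner ℂ (c k) (convectionCoeff S c c k)).re) -
          4 * Real.pi ^ 2 * m * (inner ℂ (c k) (convectionCoeff S c c k)).re := by
      intro k _
      ring
    rw [Finset.sum_congr rfl hterm, Finset.sum_sub_distrib, ← Finset.mul_sum, ← Finset.mul_sum,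
      sum_freqNormSq_mul_re_inner_convectionCoeff_eq_zero hS hc hcT,
      sum_re_inner_convectionCoeff_eq_zero hS hc hcT, mul_zero, mul_zero, sub_zero]
  rw [hsum, hconv, sub_zero]
  -- the Stokes part, termwise: `-ν w λ_k ‖c‖² ≤ -λ ν w ‖c‖²` since `ν w² ‖c‖² ≥ 0`, `λ_k - λ = w`
  have hstokes : ∑ k ∈ S, -(ν * ((4 * Real.pi ^ 2 * (freqNormSq k - m)) * (4 * Real.pi ^ 2 * freqNormSq k) * ‖c k‖ ^ 2)) ≤
      -(4 * Real.pi ^ 2 * m * ν) * ∑ k ∈ S, (4 * Real.pi ^ 2 * (freqNormSq k - m)) * ‖c k‖ ^ 2 := by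
    rw [Finset.mul_sum]
    refine Finset.sum_le_sum fun k _ => ?_
    have hc2 := sq_nonneg ‖c k‖
    have hkey : 0 ≤ ν * (4 * Real.pi ^ 2 * (freqNormSq k - m)) ^ 2 * ‖c k‖ ^ 2 := by positivity
    nlinarith
  linarith

/-- **Band-limited forcing with non-negative lower-shell work has non-positive defect.** If the
force coefficients vanish above the level `m` (`|k|² > m ⇒ g k = 0`) and every forced mode
strictly below it receives non-negative instantaneous work, `Re⟪c k, g k⟫ ≥ 0` for `|k|² < m`,
then `∑_{k∈S} 4π²(|k|² - m) Re⟪c k, g k⟫ ≤ 0` — the shellwise form of Tran–Shepherd's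
"monoscale-like" hypothesis `(Au, f) ≤ λ_max(u, f)` (Tran–Shepherd 2002, §1 and §4). For a
single forced shell `|k|² = m` the sum vanishes identically (generation 6). [cite: TranShepherd2002, §4 closing paragraphs] -/
theorem shellWeight_defect_nonpos_of_band {g c : (Fin 2 → ℤ) → EuclideanSpace ℂ (Fin 2)} (m : ℝ)
    (hband : ∀ k, m < freqNormSq k → g k = 0)
    (hwork : ∀ k ∈ S, freqNormSq k < m → 0 ≤ (inner ℂ (c k) (g k)).re) :
    ∑ k ∈ S, (4 * Real.pi ^ 2 * (freqNormSq k - m)) * (inner ℂ (c k) (g k)).re ≤ 0 := by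
  refine Finset.sum_nonpos fun k hk => ?_
  rcases lt_trichotomy (freqNormSq k) m with hlt | heq | hgt
  · -- below the top shell: negative weight, non-negative work
    have hw : 4 * Real.pi ^ 2 * (freqNormSq k - m) ≤ 0 := by
      have hπ : 0 ≤ 4 * Real.pi ^ 2 := by positivity
      exact mul_nonpos_of_nonneg_of_nonpos hπ (by linarith)
    exact mul_nonpos_of_nonpos_of_nonneg hw (hwork k hk hlt)
  · rw [heq, sub_self, mul_zero, zero_mul]
  · rw [hband k hgt, inner_zero_right, Complex.zero_re, mul_zero]

/-- **The pincer under a non-positive defect.** If `∑_{k∈S} 4π²(|k|² - m) Re⟪c k, g k⟫ ≤ 0`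
(Tran–Shepherd's monoscale-like condition `(Au,f) ≤ λ(u,f)` with `λ = 4π²m`, in particular for a
single forced shell or under `shellWeight_defect_nonpos_of_band`), then
`∑_{k∈S} w_m(k) Re⟪c k, V(g,c) k⟫ ≤ -(4π²mν) ∑_{k∈S} w_m(k)‖c k‖²`, exactly as for a single
shell (Tran–Shepherd 2002, §4: "((xi)) with the equality replaced by `≤` and with `λ_s`
replaced by `λ_max`"). [cite: TranShepherd2002, §4 closing paragraphs] -/
theorem sum_shellWeight_mul_re_inner_galerkinField_le_of_defect_nonpos {ν : ℝ} (hν : 0 ≤ ν)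
    (hS : ∀ k ∈ S, -k ∈ S) {g c : (Fin 2 → ℤ) → EuclideanSpace ℂ (Fin 2)} (hc : IsConjSymm c)
    (hcT : IsTransversal S c) (m : ℝ)
    (hdef : ∑ k ∈ S, (4 * Real.pi ^ 2 * (freqNormSq k - m)) * (inner ℂ (c k) (g k)).re ≤ 0) :
    ∑ k ∈ S, (4 * Real.pi ^ 2 * (freqNormSq k - m)) * (inner ℂ (c k) (galerkinField ν S g c k)).re ≤
      -(4 * Real.pi ^ 2 * m * ν) * ∑ k ∈ S, (4 * Real.pi ^ 2 * (freqNormSq k - m)) * ‖c k‖ ^ 2 := by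
  have h := sum_shellWeight_mul_re_inner_galerkinField_le_add_defect hν hS (g := g) hc hcT m
  linarith

end Weighted

section GalerkinSolution

variable {S : Finset (Fin 2 → ℤ)} {ν : ℝ} {g : ↥S → EuclideanSpace ℂ (Fin 2)}
  {α : ℝ → ↥S → EuclideanSpace ℂ (Fin 2)}

/-- **Tran–Shepherd's dynamical constraint for monoscale-like forcing (Galerkin level).**
Along a Galerkin solution `α` on `𝕋²` with `ν ≥ 0` and ARBITRARY force coefficients `g`, if the
injection defect is non-positive on `[0, t]`,
`∑_k 4π²(|k|² - m) Re⟪α τ k, g k⟫ ≤ 0` for `τ ∈ [0, t]` (i.e. `(Au, f) ≤ λ(u, f)` along the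
solution, `λ = 4π²m`: a single forced shell, or a band `|k|² ≤ m` whose lower modes receive
non-negative work), then the signed shell excess `ξ(τ) = ∑_k 4π²(|k|² - m)‖α τ k‖²`
(`= ‖u‖² - λ|u|²`) satisfies `ξ(t) ≤ ξ(s)e^{-8π²mν(t-s)}` for `0 ≤ s ≤ t`; in particular the
constraint `ξ ≤ 0` is invariant and positive excess is dissipated at rate `2νλ`
(Tran–Shepherd 2002, §4, (ξ)–(constraint) with `λ_s` replaced by `λ_max`). [cite: TranShepherd2002, §4 closing paragraphs] -/
theorem galerkin_shellExcess_le_mul_exp_of_defect_nonpos (hν : 0 ≤ ν) (hS : ∀ k ∈ S, -k ∈ S)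
    (hmem : ∀ t, α t ∈ galerkinSubspace S)
    (hα : ∀ T, ∀ t ∈ Icc 0 T, HasDerivWithinAt α (galerkinRHS S ν g (α t)) (Icc 0 T) t)
    (m : ℝ) {s t : ℝ} (hs : 0 ≤ s) (hst : s ≤ t)
    (hdef : ∀ τ ∈ Icc 0 t,
      ∑ k : ↥S, (4 * Real.pi ^ 2 * (freqNormSq (k : Fin 2 → ℤ) - m)) * (inner ℂ (α τ k) (g k)).re ≤ 0) :
    ∑ k : ↥S, (4 * Real.pi ^ 2 * (freqNormSq (k : Fin 2 → ℤ) - m)) * ‖α t k‖ ^ 2 ≤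
      (∑ k : ↥S, (4 * Real.pi ^ 2 * (freqNormSq (k : Fin 2 → ℤ) - m)) * ‖α s k‖ ^ 2) *
        Real.exp (-(8 * Real.pi ^ 2 * m * ν) * (t - s)) := by
  have hderiv : ∀ τ ∈ Icc 0 t, HasDerivWithinAt
      (fun σ => ∑ k : ↥S, (4 * Real.pi ^ 2 * (freqNormSq (k : Fin 2 → ℤ) - m)) * ‖α σ k‖ ^ 2)
      (∑ k : ↥S, (4 * Real.pi ^ 2 * (freqNormSq (k : Fin 2 → ℤ) - m)) *
        (2 * (inner ℂ (α τ k) (galerkinRHS S ν g (α τ) k)).re)) (Icc 0 t) τ :=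
    fun τ hτ => hasDerivWithinAt_sum_mul_norm_sq (hα t τ hτ) fun k => 4 * Real.pi ^ 2 * (freqNormSq (k : Fin 2 → ℤ) - m)
  have hle : ∀ τ ∈ Icc 0 t,
      ∑ k : ↥S, (4 * Real.pi ^ 2 * (freqNormSq (k : Fin 2 → ℤ) - m)) *
          (2 * (inner ℂ (α τ k) (galerkinRHS S ν g (α τ) k)).re) ≤
        -(8 * Real.pi ^ 2 * m * ν) *
          ∑ k : ↥S, (4 * Real.pi ^ 2 * (freqNormSq (k : Fin 2 → ℤ) - m)) * ‖α τ k‖ ^ 2 := by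
    intro τ hτ
    -- the defect, in extended coordinates
    have hdef' : ∑ k ∈ S, (4 * Real.pi ^ 2 * (freqNormSq k - m)) *
        (inner ℂ (coeffExt S (α τ) k) (coeffExt S g k)).re ≤ 0 := by
      rw [← Finset.sum_coe_sort]
      have heq : ∑ k : ↥S, (4 * Real.pi ^ 2 * (freqNormSq (k : Fin 2 → ℤ) - m)) *
          (inner ℂ (coeffExt S (α τ) k) (coeffExt S g k)).re =
          ∑ k : ↥S, (4 * Real.pi ^ 2 * (freqNormSq (k : Fin 2 → ℤ) - m)) * (inner ℂ (α τ k) (g k)).re :=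
        Finset.sum_congr rfl fun k _ => by rw [coeffExt_coe, coeffExt_coe]
      rw [heq]
      exact hdef τ hτ
    have h := sum_shellWeight_mul_re_inner_galerkinField_le_of_defect_nonpos hν hS
      ((hmem τ).1.isConjSymm_coeffExt hS) (hmem τ).2.isTransversal_coeffExt m hdef'
    rw [sum_coeffExt (fun k v => (4 * Real.pi ^ 2 * (freqNormSq k - m)) *
        (inner ℂ v (galerkinField ν S (coeffExt S g) (coeffExt S (α τ)) k)).re),
      sum_coeffExt (fun k v => (4 * Real.pi ^ 2 * (freqNormSq k - m)) * ‖v‖ ^ 2)] at h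
    have h2 : ∑ k : ↥S, (4 * Real.pi ^ 2 * (freqNormSq (k : Fin 2 → ℤ) - m)) *
          (2 * (inner ℂ (α τ k) (galerkinRHS S ν g (α τ) k)).re) =
        2 * ∑ k : ↥S, (4 * Real.pi ^ 2 * (freqNormSq (k : Fin 2 → ℤ) - m)) *
          (inner ℂ (α τ k) (galerkinField ν S (coeffExt S g) (coeffExt S (α τ)) k)).re := by
      rw [Finset.mul_sum]
      refine Finset.sum_congr rfl fun k _ => ?_
      rw [galerkinRHS_apply]
      ring
    rw [h2]
    linarith
  exact le_mul_exp_neg_of_hasDerivWithinAt_le hderiv hle hs hst le_rfl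

/-- **Band-limited force, non-negative lower-shell work ⇒ the constraint with `λ_max`.** Along a
Galerkin solution with force coefficients supported at levels `|k|² ≤ m` whose modes strictly
below `m` receive non-negative work on `[0, t]` (`Re⟪α τ k, g k⟫ ≥ 0`), the signed excess at
level `m` decays as for a single shell: `ξ(t) ≤ ξ(s)e^{-8π²mν(t-s)}`, `0 ≤ s ≤ t`
(Tran–Shepherd 2002, §4, monoscale-like case). The escape — energy injected at the top shell
and REMOVED at lower ones — is the Constantin–Foias–Manley configuration (op. cit. §1). [cite: TranShepherd2002, §1 and §4 closing paragraphs] -/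
theorem galerkin_shellExcess_le_mul_exp_of_band (hν : 0 ≤ ν) (hS : ∀ k ∈ S, -k ∈ S)
    (hmem : ∀ t, α t ∈ galerkinSubspace S)
    (hα : ∀ T, ∀ t ∈ Icc 0 T, HasDerivWithinAt α (galerkinRHS S ν g (α t)) (Icc 0 T) t)
    (m : ℝ) (hband : ∀ k : ↥S, m < freqNormSq (k : Fin 2 → ℤ) → g k = 0) {s t : ℝ} (hs : 0 ≤ s)
    (hst : s ≤ t)
    (hwork : ∀ τ ∈ Icc 0 t, ∀ k : ↥S, freqNormSq (k : Fin 2 → ℤ) < m → 0 ≤ (inner ℂ (α τ k) (g k)).re) :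
    ∑ k : ↥S, (4 * Real.pi ^ 2 * (freqNormSq (k : Fin 2 → ℤ) - m)) * ‖α t k‖ ^ 2 ≤
      (∑ k : ↥S, (4 * Real.pi ^ 2 * (freqNormSq (k : Fin 2 → ℤ) - m)) * ‖α s k‖ ^ 2) *
        Real.exp (-(8 * Real.pi ^ 2 * m * ν) * (t - s)) := by
  refine galerkin_shellExcess_le_mul_exp_of_defect_nonpos hν hS hmem hα m hs hst fun τ hτ => ?_
  -- shellwise signs, on the finite type `↥S`
  have hband' : ∀ k, m < freqNormSq k → coeffExt S g k = 0 := by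
    intro k hk
    by_cases hkS : k ∈ S
    · rw [coeffExt_of_mem _ hkS]; exact hband ⟨k, hkS⟩ hk
    · exact coeffExt_of_not_mem _ hkS
  have hwork' : ∀ k ∈ S, freqNormSq k < m → 0 ≤ (inner ℂ (coeffExt S (α τ) k) (coeffExt S g k)).re := by
    intro k hkS hk
    rw [coeffExt_of_mem _ hkS, coeffExt_of_mem _ hkS]
    exact hwork τ hτ ⟨k, hkS⟩ hk
  have h := shellWeight_defect_nonpos_of_band (S := S) m hband' hwork'
  rw [← Finset.sum_coe_sort] at h
  have heq : ∑ k : ↥S, (4 * Real.pi ^ 2 * (freqNormSq (k : Fin 2 → ℤ) - m)) *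
      (inner ℂ (coeffExt S (α τ) k) (coeffExt S g k)).re =
      ∑ k : ↥S, (4 * Real.pi ^ 2 * (freqNormSq (k : Fin 2 → ℤ) - m)) * (inner ℂ (α τ k) (g k)).re :=
    Finset.sum_congr rfl fun k _ => by rw [coeffExt_coe, coeffExt_coe]
  rw [heq] at h
  exact h

end GalerkinSolution

end Literature.Barriers.AnomalousDissipation

end
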